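import Summits.NavierStokesRegularity.FluidComputer.PalinstrophyClock
import Summits.NavierStokesRegularity.FluidComputer.SuperLadderOptimisation
import HarnessLib

/-!
# Fluid computer — the SUPER-LADDER (L54): every dyadic `ℓ²` row of index `σ > 3/2` diverges at least like
# `(T − t)^{−2σ/3}` (Benameur's exponent `σ/3` for the row's square root), with the energy as second currency

HONEST FRAMING (cell `pub-fluidc`, verbatim): *low prior, high value-of-information experiment on Tao's
machine paradigm; NOT a claim that NS blows up.* Theorem side of the cell; nothing here is evidence of blow-up.

`PalinstrophyClock` (L53) is the case `σ = 2` of a one-parameter statement. For every `σ > 3/2`, with `θ = σ − 3/2`,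
Cauchy–Schwarz over the levels above `J` gives
`∑_{n≥0} ‖Δ̇_{J+n} u‖_∞ ≤ C_B G_σ^{1/2} 2^{−θJ} (∑_{n≥0} 4^{σ(J+n)} ‖Δ̇_{J+n} u‖₂²)^{1/2}`, `G_σ = ∑_n 2^{−2θn}`, and the levels
below `J` are capped by the energy (L22′); optimising `J` (`SuperLadderOptimisation.dyadic_optimisation_gen`) yields,
along every maximal smooth Leray–Hopf solution of the unforced Navier–Stokes system on `ℝ³` (`ν > 0`):

* `tsum_tail_le_sqrt_gen`, `exists_tsum_tail_blockSup_le_gen` — the Cauchy–Schwarz step for a general index;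
* `superLadder_front_clock` (**L54**) — for every `σ > 3/2`, every `t ∈ (0, T)` and every `J ∈ ℤ`:
  `c √ν/√(T − t) ≤ C_∞ G ‖u(0)‖₂ 2^{3(J−1)/2} + C_B G_σ^{1/2} 2^{(3/2−σ)J} (∑_{n≥0} 4^{σ(J+n)} ‖Δ̇_{J+n} u(t)‖₂²)^{1/2}`;
* `superLadder_clock` (**L54′ — THE SUPER-LADDER CLOCK**) — for every `σ > 3/2` there is `κ_σ > 0` with
  `κ_σ · ν^{2σ/3} · (T − t)^{−2σ/3} ≤ ‖u(0)‖₂^{(4σ−6)/3} · ∑_{j∈ℤ} 4^{σj} ‖Δ̇_j u(t)‖₂²` at EVERY `t ∈ (0, T)`: the `ℓ²`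
  row of every index `σ > 3/2` (the dyadic `Ḣ^σ`-energy) diverges at least like `(T − t)^{−2σ/3}`, i.e. its square
  root like `‖u(0)‖₂^{(3−2σ)/3} (T − t)^{−σ/3}` — EXACTLY the shape of Benameur's printed bound
  `‖u(t)‖_{Ḣ^s} ≥ c(s) ‖u(t)‖₂^{(3−2s)/3} (T* − t)^{−s/3}` (Benameur 2010, stated there for `s > 5/2`; for `3/2 < s < 5/2`
  Robinson–Sadowski–Silva 2012 improved it to the optimal `(2s−1)/4`, which this module does NOT reach).

Reading for the atlas. Whatever high-order row a run is scored in — palinstrophy (`σ = 2`), `‖∇Δu‖₂²` (`σ = 3`), … —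
its dyadic form must diverge at least like `(T − t)^{−2σ/3}` into a realised blow-up, with the front climbing like the
amplitude front (each unpassed level certifying time `∝ 8^{−J}`). HONEST SIZE NOTE: exponent `2σ/3` is Benameur's, not
the optimal one below `σ = 5/2`; `κ_σ` inexplicit; explicit energy dependence `‖u(0)‖₂^{(4σ−6)/3}`; dyadic (`Ḃ^σ_{2,2}`)
currency, equivalent to `Ḣ^σ` only up to the (untyped for fractional `σ`) Littlewood–Paley constants; class = `ℝ³` finite
energy. Words and shapes, never numbers at the cell's levels. Necessity only; nothing about sufficiency. 0 sorry; no
new definitions, no named facts.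

## References

* J. Benameur, *On the blow-up criterion of 3D Navier–Stokes equations*, J. Math. Anal. Appl. 371 (2010)
  719–727. [Benameur2010]
* J. C. Robinson, W. Sadowski, R. P. Silva, J. Math. Phys. 53 (2012) 115618. [RobinsonSadowskiSilva2012]
* J. Leray, Acta Math. 63 (1934), §19 (3.8)–(3.9) p. 224. [Leray1934]
* H. Bahouri, J.-Y. Chemin, R. Danchin, *Fourier Analysis and Nonlinear PDE*, Springer 2011, Lemma 2.1,
  Prop. 2.12. [BahouriCheminDanchin2011]
-/

noncomputable section

open MeasureTheory Set Function Filter Topology Metric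
open scoped ENNReal NNReal
open Literature.Analysis.FluidPDE Literature.Analysis.FunctionSpaces
open Summit.NavierStokesRegularity.FluidComputer.BlockAmplitudeCeiling
open Summit.NavierStokesRegularity.FluidComputer.LeraySupClock
open Summit.NavierStokesRegularity.FluidComputer.SuperLadderOptimisation

namespace Summit.NavierStokesRegularity.FluidComputer.SuperLadder

/-! ## Cauchy–Schwarz over the levels above `J`, general index -/

/-- **Cauchy–Schwarz over a tail of levels, general index**: for `σ > 3/2`, any sequence `a : ℤ → [0, ∞]` and `J ∈ ℤ`,
`∑_{n≥0} 2^{3(J+n)/2} a_{J+n} ≤ (2^{(3−2σ)J} G_σ)^{1/2} (∑_{n≥0} 2^{2σ(J+n)} a_{J+n}²)^{1/2}`, `G_σ = ∑_n (2^{3−2σ})^n`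
(`2^{3x/2} = 2^{(3/2−σ)x}·2^{σx}`; Hölder on the counting measure). [folklore] -/
theorem tsum_tail_le_sqrt_gen (a : ℤ → ℝ≥0∞) (J : ℤ) (σ : ℝ) :
    ∑' n : ℕ, (2 : ℝ≥0∞) ^ ((3 / 2 : ℝ) * ((J + n : ℤ) : ℝ)) * a (J + n) ≤
      ((2 : ℝ≥0∞) ^ ((3 - 2 * σ) * (J : ℝ)) * ∑' n : ℕ, ((2 : ℝ≥0∞) ^ (3 - 2 * σ)) ^ n) ^ (1 / 2 : ℝ) *
        (∑' n : ℕ, (2 : ℝ≥0∞) ^ ((2 * σ) * ((J + n : ℤ) : ℝ)) * a (J + n) ^ 2) ^ (1 / 2 : ℝ) := by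
  set f : ℕ → ℝ≥0∞ := fun n => (2 : ℝ≥0∞) ^ ((3 / 2 - σ) * ((J + n : ℤ) : ℝ)) with hf
  set g : ℕ → ℝ≥0∞ := fun n => (2 : ℝ≥0∞) ^ (σ * ((J + n : ℤ) : ℝ)) * a (J + n) with hg
  have h2 : (2 : ℝ≥0∞) ≠ 0 := two_ne_zero
  have h2' : (2 : ℝ≥0∞) ≠ ⊤ := ENNReal.ofNat_ne_top
  have hfg : ∀ n, f n * g n = (2 : ℝ≥0∞) ^ ((3 / 2 : ℝ) * ((J + n : ℤ) : ℝ)) * a (J + n) := by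
    intro n
    simp only [hf, hg]
    rw [← mul_assoc, ← ENNReal.rpow_add _ _ h2 h2']
    congr 2
    ring
  have hH := ENNReal.lintegral_mul_le_Lp_mul_Lq (Measure.count : Measure ℕ) Real.HolderConjugate.two_two
    (measurable_from_nat (f := f)).aemeasurable (measurable_from_nat (f := g)).aemeasurable
  rw [lintegral_count, lintegral_count, lintegral_count] at hH
  simp only [Pi.mul_apply] at hH
  have hf2 : ∑' n : ℕ, f n ^ (2 : ℝ) = (2 : ℝ≥0∞) ^ ((3 - 2 * σ) * (J : ℝ)) * ∑' n : ℕ, ((2 : ℝ≥0∞) ^ (3 - 2 * σ)) ^ n := by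
    have hterm : ∀ n : ℕ, f n ^ (2 : ℝ) = (2 : ℝ≥0∞) ^ ((3 - 2 * σ) * (J : ℝ)) * ((2 : ℝ≥0∞) ^ (3 - 2 * σ)) ^ n := by
      intro n
      simp only [hf]
      rw [← ENNReal.rpow_mul, ← ENNReal.rpow_natCast, ← ENNReal.rpow_mul, ← ENNReal.rpow_add _ _ h2 h2']
      congr 1
      push_cast
      ring
    rw [tsum_congr hterm, ENNReal.tsum_mul_left]
  have hg2 : ∑' n : ℕ, g n ^ (2 : ℝ) = ∑' n : ℕ, (2 : ℝ≥0∞) ^ ((2 * σ) * ((J + n : ℤ) : ℝ)) * a (J + n) ^ 2 := by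
    refine tsum_congr fun n => ?_
    simp only [hg]
    rw [ENNReal.mul_rpow_of_nonneg _ _ (by norm_num : (0 : ℝ) ≤ 2), ← ENNReal.rpow_mul, ENNReal.rpow_two]
    congr 2
    ring
  calc ∑' n : ℕ, (2 : ℝ≥0∞) ^ ((3 / 2 : ℝ) * ((J + n : ℤ) : ℝ)) * a (J + n)
      = ∑' n : ℕ, f n * g n := tsum_congr fun n => (hfg n).symm
    _ ≤ (∑' n : ℕ, f n ^ (2 : ℝ)) ^ (1 / (2 : ℝ)) * (∑' n : ℕ, g n ^ (2 : ℝ)) ^ (1 / (2 : ℝ)) := hH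
    _ = _ := by rw [hf2, hg2]

/-- The geometric factor `G_σ = ∑_n (2^{3−2σ})^n` is finite for `σ > 3/2`. [folklore] -/
theorem geom_lt_top {σ : ℝ} (hσ : 3 / 2 < σ) : ∑' n : ℕ, ((2 : ℝ≥0∞) ^ (3 - 2 * σ)) ^ n < ∞ := by
  rw [ENNReal.tsum_geometric, ENNReal.inv_lt_top, tsub_pos_iff_lt]
  exact ENNReal.rpow_lt_one_of_one_lt_of_neg (by norm_num) (by linarith)

/-! ## L54: the super-ladder front clock -/

/-- **L54 — THE SUPER-LADDER FRONT CLOCK.** With the constant `c` of the sup clock (`LeraySupClock.supNorm_clock`),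
`C_∞ = (lpBounds (Fin 3)).Cinf`, `G = geomDim (Fin 3)`, `C_B` the block Bernstein constant and `G_σ = ∑_n (2^{3−2σ})^n`: for
every `σ`, along every maximal smooth Leray–Hopf solution of the unforced system (`ν > 0`), for EVERY `t ∈ (0, T)` and
EVERY `J ∈ ℤ`: `c √ν/√(T − t) ≤ C_∞ ‖u(0)‖₂ 2^{3(J−1)/2} G +
C_B (2^{(3−2σ)J} G_σ)^{1/2} (∑_{n≥0} 2^{2σ(J+n)} ‖Δ̇_{J+n} u(t)‖₂²)^{1/2}` (useful for `σ > 3/2`, where `G_σ < ∞`).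
[cite: Leray1934, §19 (3.8)–(3.9) p. 224] [cite: BahouriCheminDanchin2011, Lemma 2.1 and Prop. 2.12] -/
theorem superLadder_front_clock (σ : ℝ) :
    ∃ c : ℝ, 0 < c ∧ ∃ C : ℝ≥0, C ≠ 0 ∧ ∀ (ν T : ℝ), 0 < ν → 0 < T →
      ∀ (u : ℝ → EuclideanSpace ℝ (Fin 3) → EuclideanSpace ℝ (Fin 3)) (p : ℝ → EuclideanSpace ℝ (Fin 3) → ℝ),
      IsMaximalSmoothSolution ν 0 u p T → IsLerayHopfOn T ν 0 (u 0) u →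
      ∀ t ∈ Ioo 0 T, ∀ J : ℤ, ENNReal.ofReal (c * Real.sqrt ν / Real.sqrt (T - t)) ≤
        ((lpBounds (Fin 3)).Cinf : ℝ≥0∞) * eLpNorm (u 0) 2 volume *
            (2 : ℝ≥0∞) ^ (((J - 1 : ℤ) : ℝ) * Fintype.card (Fin 3) * 2⁻¹) * LPBounds.geomDim (Fin 3) +
          C * (((2 : ℝ≥0∞) ^ ((3 - 2 * σ) * (J : ℝ)) * ∑' n : ℕ, ((2 : ℝ≥0∞) ^ (3 - 2 * σ)) ^ n) ^ (1 / 2 : ℝ) *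
            (∑' n : ℕ, (2 : ℝ≥0∞) ^ ((2 * σ) * ((J + n : ℤ) : ℝ)) * blockL2 (u t) (J + n) ^ 2) ^ (1 / 2 : ℝ)) := by
  obtain ⟨c, hc, H⟩ := supFront_clock
  obtain ⟨CB, hCB0, hB⟩ := exists_blockSup_le_blockL2
  refine ⟨c, hc, CB, hCB0, fun ν T hν hT u p hmax hLH t ht J => (H ν T hν hT u p hmax hLH t ht J).trans ?_⟩
  refine add_le_add le_rfl ?_
  have hut : MemLp (u t) 2 volume := hLH.memLp t ⟨ht.1.le, ht.2.le⟩
  calc ∑' n : ℕ, blockSup (u t) (J + n)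
      ≤ ∑' n : ℕ, (CB : ℝ≥0∞) * ((2 : ℝ≥0∞) ^ ((3 / 2 : ℝ) * ((J + n : ℤ) : ℝ)) * blockL2 (u t) (J + n)) := by
        refine ENNReal.tsum_le_tsum fun n => ?_
        rw [← mul_assoc]
        refine (hB (u t) hut (J + n)).trans_eq ?_
        congr 2
        congr 1
        ring
    _ = (CB : ℝ≥0∞) * ∑' n : ℕ, (2 : ℝ≥0∞) ^ ((3 / 2 : ℝ) * ((J + n : ℤ) : ℝ)) * blockL2 (u t) (J + n) :=
        ENNReal.tsum_mul_left
    _ ≤ _ := mul_le_mul' le_rfl (tsum_tail_le_sqrt_gen (blockL2 (u t)) J σ)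

/-! ## L54′: the super-ladder clock -/

/-- **L54′ — THE SUPER-LADDER CLOCK.** For every `σ > 3/2` there is `κ = κ_σ > 0` such that for every `ν > 0`, `T > 0` and
every maximal smooth solution `(u, p)` of the unforced Navier–Stokes system on `ℝ³ × [0, T)` which is Leray–Hopf from
`u 0`, at EVERY `t ∈ (0, T)`:
`κ · ν^{2σ/3} · (T − t)^{−2σ/3} ≤ ‖u(0)‖₂^{(4σ−6)/3} · ∑_{j∈ℤ} 2^{2σj} ‖Δ̇_j u(t)‖₂²` — the square-root form
`(∑_j 4^{σj} a_j²)^{1/2} ≳ ν^{σ/3} ‖u(0)‖₂^{(3−2σ)/3} (T − t)^{−σ/3}` is Benameur's printed bound in dyadic currency, here for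
every `σ > 3/2` (`superLadder_front_clock` for every `J` and `dyadic_optimisation_gen` with `θ = σ − 3/2`). NOT optimal
for `σ < 5/2` (Robinson–Sadowski–Silva). [cite: Benameur2010, Thm. 1.1] [cite: Leray1934, §19 (3.8)–(3.9) p. 224]
[cite: BahouriCheminDanchin2011, Lemma 2.1 and Prop. 2.12] -/
theorem superLadder_clock (σ : ℝ) (hσ : 3 / 2 < σ) :
    ∃ κ : ℝ, 0 < κ ∧ ∀ (ν T : ℝ), 0 < ν → 0 < T →
      ∀ (u : ℝ → EuclideanSpace ℝ (Fin 3) → EuclideanSpace ℝ (Fin 3)) (p : ℝ → EuclideanSpace ℝ (Fin 3) → ℝ),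
      IsMaximalSmoothSolution ν 0 u p T → IsLerayHopfOn T ν 0 (u 0) u →
      ∀ t ∈ Ioo 0 T,
        ENNReal.ofReal (κ * ν ^ (2 * σ / 3) * (T - t) ^ (-(2 * σ / 3))) ≤
          eLpNorm (u 0) 2 volume ^ ((4 * σ - 6) / 3) *
            ∑' j : ℤ, (2 : ℝ≥0∞) ^ ((2 * σ) * (j : ℝ)) * blockL2 (u t) j ^ 2 := by
  obtain ⟨c, hc, C, hC0, H⟩ := superLadder_front_clock σ
  set θ : ℝ := σ - 3 / 2 with hθdef
  have hθ : 0 < θ := by rw [hθdef]; linarith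
  set K := lpBounds (Fin 3) with hK
  set G : ℝ≥0∞ := LPBounds.geomDim (Fin 3) with hG
  have hGtop : G ≠ ⊤ := LPBounds.geomDim_lt_top.ne
  set Gs : ℝ≥0∞ := ∑' n : ℕ, ((2 : ℝ≥0∞) ^ (3 - 2 * σ)) ^ n with hGs
  have hGstop : Gs ≠ ⊤ := (geom_lt_top hσ).ne
  set αc : ℝ := max ((K.Cinf : ℝ) * G.toReal * (2 : ℝ) ^ (-(3 / 2 : ℝ))) 1 with hαc
  have hαc1 : 1 ≤ αc := le_max_right _ _
  have hαc0 : 0 < αc := lt_of_lt_of_le one_pos hαc1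
  set β : ℝ := max ((C : ℝ) * Gs.toReal ^ (1 / 2 : ℝ)) 1 with hβ
  have hβ0 : 0 < β := lt_of_lt_of_le one_pos (le_max_right _ _)
  refine ⟨c ^ (2 + 4 * θ / 3) / ((2 : ℝ) ^ (2 + 10 * θ / 3) * β ^ 2 * αc ^ (4 * θ / 3)), by positivity,
    fun ν T hν hT u p hmax hLH t ht => ?_⟩
  have hTt : 0 < T - t := sub_pos.2 ht.2
  set E : ℝ≥0∞ := eLpNorm (u 0) 2 volume with hE
  have hEtop : E ≠ ⊤ := (hLH.memLp 0 ⟨le_rfl, hT.le⟩).eLpNorm_ne_top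
  set D : ℝ≥0∞ := ∑' j : ℤ, (2 : ℝ≥0∞) ^ ((2 * σ) * (j : ℝ)) * blockL2 (u t) j ^ 2 with hD
  set a : ℝ := c * Real.sqrt ν / Real.sqrt (T - t) with ha
  have ha0 : 0 < a := by positivity
  have hexp0 : 0 < (4 * σ - 6) / 3 := by linarith
  -- the front clock with the tail bounded by the whole row `D`
  have hfront : ∀ J : ℤ, ENNReal.ofReal a ≤
      (K.Cinf : ℝ≥0∞) * E * (2 : ℝ≥0∞) ^ (((J - 1 : ℤ) : ℝ) * Fintype.card (Fin 3) * 2⁻¹) * G +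
        C * (((2 : ℝ≥0∞) ^ ((3 - 2 * σ) * (J : ℝ)) * Gs) ^ (1 / 2 : ℝ) * D ^ (1 / 2 : ℝ)) := by
    intro J
    refine (H ν T hν hT u p hmax hLH t ht J).trans (add_le_add le_rfl (mul_le_mul' le_rfl (mul_le_mul' le_rfl ?_)))
    refine ENNReal.rpow_le_rpow ?_ (by norm_num)
    rw [hD, CriticalLevels.tsum_int_eq_low_add_tail (fun j => (2 : ℝ≥0∞) ^ ((2 * σ) * (j : ℝ)) * blockL2 (u t) j ^ 2) J]
    exact le_add_self
  by_cases hDtop : D = ⊤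
  · have hE0 : E ≠ 0 := by
      intro hE0
      have hzero : ∀ j : ℤ, blockL2 (u t) j = 0 := by
        intro j
        have hut : MemLp (u t) 2 volume := hLH.memLp t ⟨ht.1.le, ht.2.le⟩
        have h1 := K.blockL2_le hut j
        have h2 : eLpNorm (u t) 2 volume = 0 :=
          le_antisymm ((hLH.eLpNorm_le_eLpNorm_datum hν.le (hLH.memLp 0 ⟨le_rfl, hT.le⟩) ⟨ht.1.le, ht.2.le⟩).trans
            (le_of_eq hE0)) bot_le
        rw [h2, mul_zero] at h1
        exact le_antisymm h1 bot_le
      have : D = 0 := by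
        rw [hD]
        simp [hzero]
      exact absurd this (by rw [hDtop]; exact ENNReal.top_ne_zero)
    rw [hDtop, ENNReal.mul_top (by simpa [ENNReal.rpow_eq_zero_iff, hEtop, hexp0, not_lt.2 hexp0.le] using hE0)]
    exact le_top
  set d : ℝ := D.toReal with hd
  set Er : ℝ := E.toReal with hEr
  have hd0 : 0 ≤ d := ENNReal.toReal_nonneg
  have hEr0 : 0 ≤ Er := ENNReal.toReal_nonneg
  have hreal : ∀ J : ℤ, a ≤ (αc * Er) * (2 : ℝ) ^ ((3 / 2 : ℝ) * J) + β * (2 : ℝ) ^ (-θ * J) * Real.sqrt d := by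
    intro J
    set P : ℝ≥0∞ := (2 : ℝ≥0∞) ^ (((J - 1 : ℤ) : ℝ) * Fintype.card (Fin 3) * 2⁻¹) with hP
    set Q : ℝ≥0∞ := ((2 : ℝ≥0∞) ^ ((3 - 2 * σ) * (J : ℝ)) * Gs) ^ (1 / 2 : ℝ) with hQ
    have hPtop : P ≠ ⊤ := by rw [hP]; simp [ENNReal.rpow_eq_top_iff]
    have h2Jtop : (2 : ℝ≥0∞) ^ ((3 - 2 * σ) * (J : ℝ)) ≠ ⊤ := by simp [ENNReal.rpow_eq_top_iff]
    have hQtop : Q ≠ ⊤ := ENNReal.rpow_ne_top_of_nonneg (by norm_num) (ENNReal.mul_ne_top h2Jtop hGstop)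
    have hD12 : D ^ (1 / 2 : ℝ) ≠ ⊤ := ENNReal.rpow_ne_top_of_nonneg (by norm_num) hDtop
    have hhtop : (K.Cinf : ℝ≥0∞) * E * P * G ≠ ⊤ :=
      ENNReal.mul_ne_top (ENNReal.mul_ne_top (ENNReal.mul_ne_top ENNReal.coe_ne_top hEtop) hPtop) hGtop
    have httop : (C : ℝ≥0∞) * (Q * D ^ (1 / 2 : ℝ)) ≠ ⊤ :=
      ENNReal.mul_ne_top ENNReal.coe_ne_top (ENNReal.mul_ne_top hQtop hD12)
    have h1 := ENNReal.toReal_mono (ENNReal.add_ne_top.2 ⟨hhtop, httop⟩) (hfront J)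
    rw [ENNReal.toReal_ofReal ha0.le, ENNReal.toReal_add hhtop httop] at h1
    simp only [ENNReal.toReal_mul, ENNReal.coe_toReal] at h1
    have hP' : P.toReal = (2 : ℝ) ^ ((3 / 2 : ℝ) * J) * (2 : ℝ) ^ (-(3 / 2 : ℝ)) := by
      rw [hP, ← ENNReal.toReal_rpow, ENNReal.toReal_ofNat, ← Real.rpow_add two_pos]
      congr 1
      push_cast
      simp
      ring
    have hQ' : Q.toReal = Gs.toReal ^ (1 / 2 : ℝ) * (2 : ℝ) ^ (-θ * J) := by
      rw [hQ, ← ENNReal.toReal_rpow, ENNReal.toReal_mul, ← ENNReal.toReal_rpow, ENNReal.toReal_ofNat,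
        Real.mul_rpow (by positivity) ENNReal.toReal_nonneg, ← Real.rpow_mul (by norm_num), mul_comm]
      congr 2
      rw [hθdef]
      ring
    have hD' : (D ^ (1 / 2 : ℝ)).toReal = Real.sqrt d := by
      rw [← ENNReal.toReal_rpow, Real.sqrt_eq_rpow]
    rw [hP', hQ', hD'] at h1
    have hhead : (K.Cinf : ℝ) * Er * ((2 : ℝ) ^ ((3 / 2 : ℝ) * J) * (2 : ℝ) ^ (-(3 / 2 : ℝ))) * G.toReal ≤
        αc * Er * (2 : ℝ) ^ ((3 / 2 : ℝ) * J) := by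
      have e : (K.Cinf : ℝ) * Er * ((2 : ℝ) ^ ((3 / 2 : ℝ) * J) * (2 : ℝ) ^ (-(3 / 2 : ℝ))) * G.toReal =
          ((K.Cinf : ℝ) * G.toReal * (2 : ℝ) ^ (-(3 / 2 : ℝ))) * Er * (2 : ℝ) ^ ((3 / 2 : ℝ) * J) := by ring
      rw [e]
      refine mul_le_mul_of_nonneg_right (mul_le_mul_of_nonneg_right (le_max_left _ _) hEr0) (by positivity)
    have htail : (C : ℝ) * (Gs.toReal ^ (1 / 2 : ℝ) * (2 : ℝ) ^ (-θ * J) * Real.sqrt d) ≤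
        β * (2 : ℝ) ^ (-θ * J) * Real.sqrt d := by
      have e : (C : ℝ) * (Gs.toReal ^ (1 / 2 : ℝ) * (2 : ℝ) ^ (-θ * J) * Real.sqrt d) =
          ((C : ℝ) * Gs.toReal ^ (1 / 2 : ℝ)) * ((2 : ℝ) ^ (-θ * J) * Real.sqrt d) := by ring
      rw [e, mul_assoc β]
      exact mul_le_mul_of_nonneg_right (le_max_left _ _) (by positivity)
    calc a ≤ _ := h1
      _ ≤ αc * Er * (2 : ℝ) ^ ((3 / 2 : ℝ) * J) + β * (2 : ℝ) ^ (-θ * J) * Real.sqrt d := add_le_add hhead htail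
  have hopt := dyadic_optimisation_gen ha0 (by positivity : 0 ≤ αc * Er) hβ0 hd0 hθ hreal
  -- unpack the exponents: `2 + 4θ/3 = 4σ/3`, `4θ/3 = (4σ − 6)/3`
  have e1 : 2 + 4 * θ / 3 = 4 * σ / 3 := by rw [hθdef]; ring
  have e2 : 4 * θ / 3 = (4 * σ - 6) / 3 := by rw [hθdef]; ring
  have ha83 : a ^ (4 * σ / 3) = c ^ (4 * σ / 3) * ν ^ (2 * σ / 3) * (T - t) ^ (-(2 * σ / 3)) := by
    rw [ha, div_eq_mul_inv, Real.mul_rpow (by positivity) (by positivity), Real.mul_rpow hc.le (Real.sqrt_nonneg _),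
      Real.sqrt_eq_rpow, Real.sqrt_eq_rpow, ← Real.rpow_mul hν.le, Real.inv_rpow (by positivity),
      ← Real.rpow_mul hTt.le, ← Real.rpow_neg hTt.le]
    congr 2
    · congr 1; ring
    · congr 1; ring
  have hαE : (αc * Er) ^ ((4 * σ - 6) / 3) = αc ^ ((4 * σ - 6) / 3) * Er ^ ((4 * σ - 6) / 3) :=
    Real.mul_rpow hαc0.le hEr0
  rw [e1, e2, ha83, hαE] at hopt
  have hκ : c ^ (4 * σ / 3) / ((2 : ℝ) ^ (2 + 10 * θ / 3) * β ^ 2 * αc ^ ((4 * σ - 6) / 3)) * ν ^ (2 * σ / 3) *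
      (T - t) ^ (-(2 * σ / 3)) ≤ Er ^ ((4 * σ - 6) / 3) * d := by
    have hden : 0 < (2 : ℝ) ^ (2 + 10 * θ / 3) * β ^ 2 * αc ^ ((4 * σ - 6) / 3) := by positivity
    rw [div_mul_eq_mul_div, div_mul_eq_mul_div, div_le_iff₀ hden]
    calc c ^ (4 * σ / 3) * ν ^ (2 * σ / 3) * (T - t) ^ (-(2 * σ / 3))
        ≤ (2 : ℝ) ^ (2 + 10 * θ / 3) * β ^ 2 * (αc ^ ((4 * σ - 6) / 3) * Er ^ ((4 * σ - 6) / 3)) * d := hopt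
      _ = Er ^ ((4 * σ - 6) / 3) * d * ((2 : ℝ) ^ (2 + 10 * θ / 3) * β ^ 2 * αc ^ ((4 * σ - 6) / 3)) := by ring
  have hE' : E ^ ((4 * σ - 6) / 3) = ENNReal.ofReal (Er ^ ((4 * σ - 6) / 3)) := by
    rw [hEr, ← ENNReal.ofReal_rpow_of_nonneg ENNReal.toReal_nonneg hexp0.le, ENNReal.ofReal_toReal hEtop]
  have hDd : D = ENNReal.ofReal d := (ENNReal.ofReal_toReal hDtop).symm
  rw [show c ^ (2 + 4 * θ / 3) = c ^ (4 * σ / 3) by rw [e1], show αc ^ (4 * θ / 3) = αc ^ ((4 * σ - 6) / 3) by rw [e2],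
    hE', hDd, ← ENNReal.ofReal_mul (by positivity)]
  exact ENNReal.ofReal_le_ofReal hκ

end Summit.NavierStokesRegularity.FluidComputer.SuperLadder

end
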